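import Literature.NumberTheory.GaloisRepresentations.SymplecticMultiplierDeterminant
import Literature.NumberTheory.GaloisRepresentations.SymplecticMultiplierStandardFormProofs
import Literature.LinearAlgebra.Matrix.PfaffianSimilitude
import HarnessLib

/-!
# Symplectic framed representations of any rank over a commutative ring: `det ρ(g) = ν(g)^{n/2}`

Sequel of `SymplecticMultiplierDeterminant.lean` and `GSpValued.lean`. State of the tree before
this file:

* `SymplecticMultiplierDeterminant.lean`: `det ρ(g)² = ν(g)ⁿ` in every rank over any commutative
  ring, and `det ρ(g) = ν(g)²` in rank `4` only, by a hand-expanded `4 × 4` Pfaffian ("Mathlib has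
  no Pfaffian");
* `GSpValued.lean`: `det g = ν ^ (n / 2)` for a similitude `gᵀ J g = ν J` of a non-degenerate
  alternating `J` over a FIELD (`det_eq_pow_of_alternating`, `FramedRep.det_eq_multiplier_pow`,
  `FramedRep.IsGSpValued.det_eq_pow`), by the symplectic basis theorem (McDuff–Salamon 2.1.3) and
  Mathlib's `SymplecticGroup.det_eq_one`; over a commutative ring only for the standard form
  `Matrix.J l R` with a UNIT multiplier (`det_eq_pow_of_isSimilitude_J`).

With the tree's Pfaffian of arbitrary size (`Literature/LinearAlgebra/Matrix/Pfaffian*.lean`) and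
the Book of Involutions' (12.3) in its ring-general matrix form
(`PfaffianSimilitude.det_eq_pow_of_transpose_mul_mul_eq_smul`: `gᵀ B g = μ B`, `B` alternating,
`det B` a non-zero-divisor ⟹ `det g = μ^{n/2}`), both restrictions — the coefficient field and
the rank `4` — disappear, for ANY multiplier:

* `IsSimilitude.det_eq_pow_card_div_two` — in the vocabulary of `GSpValued`: a similitude
  `IsSimilitude J ν g` of an alternating `J` (`Jᵀ = -J`, zero diagonal) with `det J` a
  non-zero-divisor, over a commutative ring, has `det g = ν ^ (#ι / 2)`;
* `FramedRep.det_eq_multiplier_pow_of_isUnit` / `FramedRep.IsGSpValued.det_eq_pow_commRing` — the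
  ring versions of `FramedRep.det_eq_multiplier_pow` / `FramedRep.IsGSpValued.det_eq_pow`;
* `FramedGaloisRep.IsSymplecticWithMultiplierFun.det_eq_pow_of_diag_eq_zero`,
  `…det_eq_pow_of_two_ne_zero`, `…det_eq_pow`, `…det_eq_pow_half`, `…even_rank` — the rank-`n`
  versions of the rank-`4` theorems `det_eq_sq_of_diag_eq_zero`, `det_eq_sq_of_two_ne_zero`,
  `det_eq_sq` of `SymplecticMultiplierDeterminant.lean` (coefficients: any commutative ring with
  `2` a non-zero-divisor, e.g. `𝓞`, `ℚ̄_p`, a field of odd characteristic): `det ρ(g) = ν(g)^{n/2}`.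

Boxer–Calegari–Gee–Pilloni 2021, §2 fix the convention "`ν` the similitude character" of
`GSp₄ = {g : gᵀ J g = ν(g) J}`; the determinant formula is the Book of Involutions (12.3) /
Artin, *Geometric Algebra*, Thm. 3.28. Everything is proved; no definitions, no named facts.

## References

* [KnusEtAl1998] M.-A. Knus, A. Merkurjev, M. Rost, J.-P. Tignol, *The Book of Involutions* (1998),
  §12.A (12.3) Proposition.
* [BoxerEtAl2021] G. Boxer, F. Calegari, T. Gee, V. Pilloni, *Abelian surfaces over totally real
  fields are potentially modular*, Publ. IHÉS 134 (2021), §2 (`GSp₄`, similitude `ν`).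
* [Artin1988] E. Artin, *Geometric Algebra*, Thm. 3.28.
-/

namespace Literature.NumberTheory.GaloisRepresentations

open Field Matrix
open Literature.LinearAlgebra.Matrix (det_eq_pow_of_transpose_mul_mul_eq_smul_of_isUnit
  det_eq_pow_card_div_two_of_transpose_mul_mul_eq_smul even_of_isRegular_det)

universe u v

/-! ## Similitudes over a commutative ring -/

section Similitude

variable {ι : Type*} [Fintype ι] [DecidableEq ι] {R : Type*} [CommRing R]

/-- **Book of Involutions (12.3) over a commutative ring, `IsSimilitude` vocabulary.** A
similitude `gᵀ J g = ν J` of an alternating matrix `J` (`Jᵀ = -J`, zero diagonal) whose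
determinant is a non-zero-divisor has `det g = ν ^ (#ι / 2)` — any multiplier `ν`, any
commutative ring (over a field: `det_eq_pow_of_alternating` of `GSpValued`).
[cite: KnusEtAl1998, §12.A (12.3) Proposition] -/
theorem IsSimilitude.det_eq_pow_card_div_two {J g : Matrix ι ι R} {ν : R}
    (h : IsSimilitude J ν g) (hJt : Jᵀ = -J) (hJd : ∀ i, J i i = 0) (hJ : IsRegular J.det) :
    g.det = ν ^ (Fintype.card ι / 2) :=
  det_eq_pow_card_div_two_of_transpose_mul_mul_eq_smul J g hJt hJd hJ h

/-- `IsSimilitude` version with `det J` a unit (the `GSp(J)` of `FramedRep.IsGSpValued`).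
[cite: KnusEtAl1998, §12.A (12.3) Proposition] -/
theorem IsSimilitude.det_eq_pow_card_div_two_of_isUnit {J g : Matrix ι ι R} {ν : R}
    (h : IsSimilitude J ν g) (hJt : Jᵀ = -J) (hJd : ∀ i, J i i = 0) (hJ : IsUnit J.det) :
    g.det = ν ^ (Fintype.card ι / 2) :=
  h.det_eq_pow_card_div_two hJt hJd hJ.isRegular

/-- When `2` is a non-zero-divisor, `Jᵀ = -J` already forces the zero diagonal.
[cite: KnusEtAl1998, §12.A (12.3) Proposition] -/
theorem IsSimilitude.det_eq_pow_card_div_two_of_two_ne_zero {J g : Matrix ι ι R} {ν : R}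
    (h : IsSimilitude J ν g) (hJt : Jᵀ = -J) (h2 : IsRegular (2 : R)) (hJ : IsRegular J.det) :
    g.det = ν ^ (Fintype.card ι / 2) :=
  h.det_eq_pow_card_div_two hJt
    (apply_self_eq_zero_of_transpose_eq_neg hJt fun a ha => h2.left (by simpa using ha)) hJ

end Similitude

/-! ## `GSp`-valued framed representations over a commutative ring -/

section Framed

variable {G : Type*} [Group G] [TopologicalSpace G] {A : Type v} [CommRing A] [TopologicalSpace A]
  {n : ℕ}

/-- **`det ρ(g) = ν(g) ^ (n / 2)`** for a framed representation preserving an alternating Gram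
matrix `J` (`Jᵀ = -J`, zero diagonal, `det J ∈ Aˣ`) up to `ν(g)`, over ANY commutative coefficient
ring — the ring version of `FramedRep.det_eq_multiplier_pow` (`GSpValued`, fields).
[cite: KnusEtAl1998, §12.A (12.3) Proposition] [cite: BoxerEtAl2021, §2] -/
theorem FramedRep.det_eq_multiplier_pow_of_isUnit (ρ : FramedRep G A n)
    {J : Matrix (Fin n) (Fin n) A} {ν : G → A} (hJ : IsUnit J.det) (hJt : Jᵀ = -J)
    (hJd : ∀ i, J i i = 0)
    (hν : ∀ g, (ρ g : Matrix (Fin n) (Fin n) A)ᵀ * J * (ρ g : Matrix (Fin n) (Fin n) A) = ν g • J)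
    (g : G) : (ρ g : Matrix (Fin n) (Fin n) A).det = ν g ^ (n / 2) :=
  det_eq_pow_of_transpose_mul_mul_eq_smul_of_isUnit J _ hJt hJd hJ (hν g)

/-- Ring version of `FramedRep.IsGSpValued.det_eq_pow`: a `GSp`-valued framed representation over a
commutative ring has a Gram matrix and a multiplier with `det ρ(g) = ν(g) ^ (n / 2)` for all `g`.
[cite: KnusEtAl1998, §12.A (12.3) Proposition] [cite: BoxerEtAl2021, §2] -/
theorem FramedRep.IsGSpValued.det_eq_pow_commRing {ρ : FramedRep G A n} (h : ρ.IsGSpValued) :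
    ∃ (J : Matrix (Fin n) (Fin n) A) (ν : G → A), IsUnit J.det ∧ Jᵀ = -J ∧ (∀ i, J i i = 0) ∧
      (∀ g, (ρ g : Matrix (Fin n) (Fin n) A)ᵀ * J * (ρ g : Matrix (Fin n) (Fin n) A) = ν g • J) ∧
      ∀ g, (ρ g : Matrix (Fin n) (Fin n) A).det = ν g ^ (n / 2) := by
  obtain ⟨J, hJ, hJt, hJd, ν, hν⟩ := h
  exact ⟨J, ν, hJ, hJt, hJd, hν, FramedRep.det_eq_multiplier_pow_of_isUnit ρ hJ hJt hJd hν⟩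

/-- A `GSp`-valued framed representation over a nontrivial commutative ring has EVEN rank
("necessarily even", Book of Involutions (12.3): `det J = (pf J)² = 0` for odd `n`) — the ring
version of `FramedRep.IsGSpValued.even`. [cite: KnusEtAl1998, §12.A (12.3) Proposition] -/
theorem FramedRep.IsGSpValued.even_commRing [Nontrivial A] {ρ : FramedRep G A n}
    (h : ρ.IsGSpValued) : Even n := by
  obtain ⟨J, hJ, hJt, hJd, -, -⟩ := h
  exact even_of_isRegular_det J hJt hJd hJ.isRegular

end Framed

/-! ## `IsSymplecticWithMultiplierFun` in any rank -/

section Galois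

variable {K : Type u} [Field K] {A : Type v} [CommRing A] [TopologicalSpace A] {n : ℕ}

/-- **`GSp_n`: the similitude determines the determinant, `det ρ(g) = ν(g)^{n/2}`**, for a rank-`n`
framed Galois representation symplectic with multiplier `ν` whose Gram matrix can be taken with zero
diagonal (genuinely alternating; automatic when `2` is a non-zero-divisor,
`det_eq_pow_of_two_ne_zero`), over ANY commutative coefficient ring — the rank-`n` version of
`det_eq_sq_of_diag_eq_zero`. Proof (Book of Involutions (12.3)):
`det ρ(g) · pf J = pf(ρ(g)ᵀ J ρ(g)) = pf(ν(g) J) = ν(g)^{n/2} pf J` and `pf J` is a unit since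
`(pf J)² = det J ∈ Aˣ`. Here `n / 2` is natural-number division (`n` is even anyway, `even_rank`).
[cite: KnusEtAl1998, §12.A (12.3) Proposition] [cite: BoxerEtAl2021, §2] -/
theorem FramedGaloisRep.IsSymplecticWithMultiplierFun.det_eq_pow_of_diag_eq_zero
    {ρ : FramedGaloisRep K A n} {ν : absoluteGaloisGroup K → A}
    (h : ∃ J : Matrix (Fin n) (Fin n) A, Jᵀ = -J ∧ (∀ i, J i i = 0) ∧ IsUnit J.det ∧
      ∀ g : absoluteGaloisGroup K, (ρ g).valᵀ * J * (ρ g).val = ν g • J)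
    (g : absoluteGaloisGroup K) :
    ((ρ g : GL (Fin n) A) : Matrix (Fin n) (Fin n) A).det = ν g ^ (n / 2) := by
  obtain ⟨J, hJT, hd, hJdet, hJ⟩ := h
  exact det_eq_pow_of_transpose_mul_mul_eq_smul_of_isUnit J _ hJT hd hJdet (hJ g)

/-- **`GSp_n`: `det ρ(g) = ν(g)^{n/2}`** for a rank-`n` representation symplectic with multiplier
`ν` (`IsSymplecticWithMultiplierFun`), over any commutative coefficient ring in which `2` is a
non-zero-divisor (so that `Jᵀ = -J` forces a zero diagonal) — e.g. `ℚ̄_p`, `𝓞`, or a field of odd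
characteristic; the rank-`n` version of `det_eq_sq_of_two_ne_zero`.
[cite: KnusEtAl1998, §12.A (12.3) Proposition] [cite: BoxerEtAl2021, §2] -/
theorem FramedGaloisRep.IsSymplecticWithMultiplierFun.det_eq_pow_of_two_ne_zero
    {ρ : FramedGaloisRep K A n} {ν : absoluteGaloisGroup K → A}
    (h : ρ.IsSymplecticWithMultiplierFun ν) (h2 : IsRegular (2 : A)) (g : absoluteGaloisGroup K) :
    ((ρ g : GL (Fin n) A) : Matrix (Fin n) (Fin n) A).det = ν g ^ (n / 2) := by
  obtain ⟨J, hJT, hJdet, hJ⟩ := h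
  exact FramedGaloisRep.IsSymplecticWithMultiplierFun.det_eq_pow_of_diag_eq_zero
    ⟨J, hJT, apply_self_eq_zero_of_transpose_eq_neg hJT fun a ha => h2.left (by simpa using ha),
      hJdet, hJ⟩ g

/-- **`GSp_n` over a field of characteristic `≠ 2`: `det ρ(g) = ν(g)^{n/2}`** — the rank-`n`
version of `det_eq_sq`. [cite: KnusEtAl1998, §12.A (12.3) Proposition] [cite: BoxerEtAl2021, §2] -/
theorem FramedGaloisRep.IsSymplecticWithMultiplierFun.det_eq_pow {L : Type v} [Field L]
    [TopologicalSpace L] [NeZero (2 : L)] {ρ : FramedGaloisRep K L n}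
    {ν : absoluteGaloisGroup K → L} (h : ρ.IsSymplecticWithMultiplierFun ν)
    (g : absoluteGaloisGroup K) :
    ((ρ g : GL (Fin n) L) : Matrix (Fin n) (Fin n) L).det = ν g ^ (n / 2) :=
  h.det_eq_pow_of_two_ne_zero (IsRegular.of_ne_zero (NeZero.ne 2)) g

/-- **A representation symplectic with a multiplier has even rank** ("necessarily even", Book of
Involutions (12.3)): over a nontrivial coefficient ring with `2` a non-zero-divisor, an invertible
alternating `n × n` Gram matrix exists only for even `n` (`det J = (pf J)² = 0` for odd `n`).
[cite: KnusEtAl1998, §12.A (12.3) Proposition] -/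
theorem FramedGaloisRep.IsSymplecticWithMultiplierFun.even_rank [Nontrivial A]
    {ρ : FramedGaloisRep K A n} {ν : absoluteGaloisGroup K → A}
    (h : ρ.IsSymplecticWithMultiplierFun ν) (h2 : IsRegular (2 : A)) : Even n := by
  obtain ⟨J, hJT, hJdet, -⟩ := h
  exact even_of_isRegular_det J hJT
    (apply_self_eq_zero_of_transpose_eq_neg hJT fun a ha => h2.left (by simpa using ha))
    hJdet.isRegular

/-- **`GSp_{2m}`: `det ρ(g) = ν(g)^m`** — the even-rank spelling (`n = 2 m`) over a commutative ring
with `2` a non-zero-divisor; at `m = 2` this is `det_eq_sq_of_two_ne_zero` (`GSp₄`: `det = sim²`),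
and for the representation on `H¹` of an abelian variety of dimension `m` with similitude `ε⁻¹` it
reads `det = ε^{-m}`. [cite: KnusEtAl1998, §12.A (12.3) Proposition] [cite: BoxerEtAl2021, §2] -/
theorem FramedGaloisRep.IsSymplecticWithMultiplierFun.det_eq_pow_half {m : ℕ}
    {ρ : FramedGaloisRep K A (2 * m)} {ν : absoluteGaloisGroup K → A}
    (h : ρ.IsSymplecticWithMultiplierFun ν) (h2 : IsRegular (2 : A)) (g : absoluteGaloisGroup K) :
    ((ρ g : GL (Fin (2 * m)) A) : Matrix (Fin (2 * m)) (Fin (2 * m)) A).det = ν g ^ m := by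
  rw [h.det_eq_pow_of_two_ne_zero h2 g, Nat.mul_div_cancel_left m two_pos]

/-- Consistency with the rank-`4` file: for `GSp₄` the general formula gives `det ρ(g) = ν(g)²`
(`4 / 2 = 2`), the statement of `det_eq_sq_of_two_ne_zero`. [cite: BoxerEtAl2021, §2] -/
example {ρ : FramedGaloisRep K A 4} {ν : absoluteGaloisGroup K → A}
    (h : ρ.IsSymplecticWithMultiplierFun ν) (h2 : IsRegular (2 : A)) (g : absoluteGaloisGroup K) :
    ((ρ g : GL (Fin 4) A) : Matrix (Fin 4) (Fin 4) A).det = ν g ^ 2 :=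
  h.det_eq_pow_of_two_ne_zero h2 g

end Galois

end Literature.NumberTheory.GaloisRepresentations
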